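import Mathlib.Analysis.SpecialFunctions.Pow.Real
import Literature.Computability.Complexity.AOWTraceWalks
import Literature.Computability.Complexity.AOWWalkCounting
import Literature.Computability.Complexity.AOWScanChains
import HarnessLib

/-!
# Configurations of AOW's odd matrix: the expansion of `tr((AᵀA)^m)` and the counting bounds
(Allen–O'Donnell–Witmer 2015, App. A.4, proof of Lemma A.2 — deterministic part)

Trunk T-CPLX-CORE (Literature/Computability/Complexity). Support file for the discharge of the
named fact `allen_odonnell_witmer_kSAT` (`AOWRefutation.lean`), probabilistic part VI.

Labels `λ ∈ Λ` lie over triples `(b₁ λ, b₂ λ, lst λ) ∈ I × I × K` and carry weights `g λ`; the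
tensor `w(i,j,ℓ) = ∑_{λ over (i,j,ℓ)} g λ` (`tensorOf`) and AOW's matrix `A = oddMatrixOf w` on
`(I × I) × (I × I)` (eq. (A-def): `A_{(i,i'),(j,j')} = [(i,j) ≠ (i',j')] ∑_ℓ w(i,j,ℓ) w(i',j',ℓ)`;
`oddMatrixOf` is the ring-generic form of `oddMatrix` of `AOWOddLevel.lean`). We prove:

* `trace_pow_oddMatrixOf_tensorOf` — **the expansion**
  `tr((AᵀA)^{n+1}) = ∑_{Q,P} ∑_{ℓ} ∑_{lab, lab'} [Valid] ∏_σ g(lab σ) g(lab' σ)` over row/column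
  pair sequences `P, Q : ℤ/(n+1) → I × I`, last coordinates `ℓ` and labels `lab, lab'` on the
  `2(n+1)` slots `σ = (t, s)` (entries `A(P_t, Q_t)`, `A(P_t, Q_{t+1})`), where `Valid` says: the
  entry is off-diagonal and the two labels lie over the two triples `tripleAt P Q ℓ t s 0/1` of the
  slot (`AOWScanChains.lean`);
* consequences of validity: the triples of the labels are the configuration's triples
  (`image_tripleOfLabel_eq_tripleSet`), the two triples of a slot differ;
* **the counts** `card_filter_blockSet_le` (`#{(P,Q) : a blocks} ≤ |I|·(4m)^{4m-1}·|I|^{a-1}`),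
  `card_filter_image_lst_le` (`#{ℓ : b values} ≤ |K|·(2m)^{2m-1}·|K|^{b-1}`) via
  `AOWWalkCounting`, and `sum_valid_labels_le` (`#valid (lab, lab') ≤ λ₀^{4m}`);
* **Claim 10** `claim10` : `N^a n^b p^{max(2b, a-3)} ≤ N^4 (N² n p²)^m` for `a ≤ 2m+3`, `b ≤ m`,
  `N² n p² ≥ 1`.

## References

* S. R. Allen, R. O'Donnell, D. Witmer, *How to refute a random CSP*, FOCS 2015,
  arXiv:1505.04383, App. A.2 (eq. (A-def)), App. A.4 (proof of Lemma A.2: expansion of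
  `tr((AAᵀ)^r)`, the sets `J`, `L`, Claims 6–10).
-/

noncomputable section

namespace Literature.Computability.Complexity

open Finset Matrix

variable {I K Λ : Type} [Fintype I] [Fintype K] [Fintype Λ]
variable [DecidableEq I] [DecidableEq K] [DecidableEq Λ]

/-! ### Tensors of label weights and AOW's matrix over a general ring -/

section Generic

variable {R : Type} [CommRing R]

/-- The label `λ` lies over the triple `τ = (i, j, ℓ)`. [Allen–O'Donnell–Witmer 2015, App. A
(`w(T)` as a sum over the constraints with scope `T`)] [folklore] -/
def OverTriple (b₁ b₂ : Λ → I) (lst : Λ → K) (l : Λ) (τ : I × I × K) : Prop :=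
  b₁ l = τ.1 ∧ b₂ l = τ.2.1 ∧ lst l = τ.2.2

omit [Fintype I] [Fintype K] [Fintype Λ] [DecidableEq Λ] [DecidableEq I] [DecidableEq K] in
/-- `OverTriple` means the triple of the label is `τ`. [folklore] -/
theorem overTriple_iff (b₁ b₂ : Λ → I) (lst : Λ → K) (l : Λ) (τ : I × I × K) :
    OverTriple b₁ b₂ lst l τ ↔ (b₁ l, b₂ l, lst l) = τ := by
  obtain ⟨i, j, k⟩ := τ
  simp [OverTriple, Prod.ext_iff]

/-- `OverTriple` is decidable. [folklore] -/
instance instDecidableOverTriple (b₁ b₂ : Λ → I) (lst : Λ → K) (l : Λ) (τ : I × I × K) :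
    Decidable (OverTriple b₁ b₂ lst l τ) := by
  unfold OverTriple
  infer_instance

/-- The tensor of label weights: `w(i,j,ℓ) = ∑_{λ over (i,j,ℓ)} g λ`. [Allen–O'Donnell–Witmer 2015,
Cor. 4.2 (`w(T) = ∑_c ±1{(T,c) ∈ I}`) and App. A.2] [cite: arXiv150504383, App. A.2] -/
def tensorOf (b₁ b₂ : Λ → I) (lst : Λ → K) (g : Λ → R) (i j : I) (l : K) : R :=
  ∑ x, if OverTriple b₁ b₂ lst x (i, j, l) then g x else 0

/-- **AOW's matrix over a general ring**: `A_{(i,i'),(j,j')} = [¬(i = i' ∧ j = j')] ∑_ℓ w(i,j,ℓ) w(i',j',ℓ)`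
(the `ℤ`-valued `oddMatrix` of `AOWOddLevel.lean` is the case `R = ℤ`, `K = Fin n`).
[Allen–O'Donnell–Witmer 2015, App. A.2, eq. (A-def)] [cite: arXiv150504383, App. A.2] -/
def oddMatrixOf (w : I → I → K → R) : Matrix (I × I) (I × I) R :=
  Matrix.of fun p q => if p.1 = p.2 ∧ q.1 = q.2 then 0 else ∑ l, w p.1 q.1 l * w p.2 q.2 l

/-- The condition on one entry's expansion data `(ℓ, λ, λ')`: the entry `A(X, Y)` is off-diagonal
and `λ`, `λ'` lie over `(X.1, Y.1, ℓ)`, `(X.2, Y.2, ℓ)`. [Allen–O'Donnell–Witmer 2015, App. A.4] [folklore] -/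
def EntryOK (b₁ b₂ : Λ → I) (lst : Λ → K) (X Y : I × I) (l : K) (x x' : Λ) : Prop :=
  ¬ (X.1 = X.2 ∧ Y.1 = Y.2) ∧ OverTriple b₁ b₂ lst x (X.1, Y.1, l) ∧ OverTriple b₁ b₂ lst x' (X.2, Y.2, l)

/-- `EntryOK` is decidable. [folklore] -/
instance instDecidableEntryOK (b₁ b₂ : Λ → I) (lst : Λ → K) (X Y : I × I) (l : K) (x x' : Λ) :
    Decidable (EntryOK b₁ b₂ lst X Y l x x') := by
  unfold EntryOK
  infer_instance

omit [DecidableEq Λ] [Fintype I] in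
/-- **Expansion of one entry**: `A(X,Y) = ∑_{ℓ,λ,λ'} [EntryOK] g λ g λ'`.
[Allen–O'Donnell–Witmer 2015, App. A.4] [folklore] -/
theorem oddMatrixOf_tensorOf_apply (b₁ b₂ : Λ → I) (lst : Λ → K) (g : Λ → R) (X Y : I × I) :
    oddMatrixOf (tensorOf b₁ b₂ lst g) X Y =
      ∑ l, ∑ x, ∑ x', if EntryOK b₁ b₂ lst X Y l x x' then g x * g x' else 0 := by
  simp only [oddMatrixOf, Matrix.of_apply, EntryOK]
  by_cases hdiag : X.1 = X.2 ∧ Y.1 = Y.2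
  · rw [if_pos hdiag]
    symm
    exact Finset.sum_eq_zero fun l _ => Finset.sum_eq_zero fun x _ =>
      Finset.sum_eq_zero fun x' _ => by rw [if_neg (fun h => h.1 hdiag)]
  · rw [if_neg hdiag]
    refine Finset.sum_congr rfl fun l _ => ?_
    rw [tensorOf, tensorOf, Finset.sum_mul_sum]
    refine Finset.sum_congr rfl fun x _ => Finset.sum_congr rfl fun x' _ => ?_
    by_cases h1 : OverTriple b₁ b₂ lst x (X.1, Y.1, l) <;>
      by_cases h2 : OverTriple b₁ b₂ lst x' (X.2, Y.2, l) <;> simp [h1, h2, hdiag]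

/-! ### Configurations and the expansion of `tr((AᵀA)^{n+1})` -/

variable {n : ℕ}

/-- A configuration of labels on the `2(n+1)` slots is **valid** for `(P, Q, ℓ)`: every entry is
off-diagonal and its two labels lie over its two triples. [Allen–O'Donnell–Witmer 2015, App. A.4
(the conditions (tr1)–(tr3) and the index pattern of `P_{J,L}`)] [cite: arXiv150504383, App. A] -/
def Valid (b₁ b₂ : Λ → I) (lst : Λ → K) (P Q : Fin (n + 1) → I × I) (ℓ : Fin (n + 1) × Fin 2 → K)
    (lab lab' : Fin (n + 1) × Fin 2 → Λ) : Prop :=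
  ∀ σ, EntryOK b₁ b₂ lst (P σ.1) (colPair Q σ.1 σ.2) (ℓ σ) (lab σ) (lab' σ)

/-- `Valid` is decidable. [folklore] -/
instance instDecidableValid (b₁ b₂ : Λ → I) (lst : Λ → K) (P Q : Fin (n + 1) → I × I)
    (ℓ : Fin (n + 1) × Fin 2 → K) (lab lab' : Fin (n + 1) × Fin 2 → Λ) :
    Decidable (Valid b₁ b₂ lst P Q ℓ lab lab') := by
  unfold Valid
  infer_instance

omit [Fintype I] [Fintype Λ] [DecidableEq I] [DecidableEq K] [DecidableEq Λ] in
/-- The closed-walk product over `ℤ/(n+1)` as a product over the slots `(t, s)`. [folklore] -/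
theorem prod_walk_eq_prod_slots (A : Matrix (I × I) (I × I) R) (P Q : Fin (n + 1) → I × I) :
    ∏ j, A (P j) (Q j) * A (P j) (Q (j + 1)) =
      ∏ σ : Fin (n + 1) × Fin 2, A (P σ.1) (colPair Q σ.1 σ.2) := by
  rw [Fintype.prod_prod_type]
  refine Finset.prod_congr rfl fun t _ => ?_
  rw [Fin.prod_univ_two]
  simp [colPair]

omit [DecidableEq Λ] in
/-- **The expansion of `tr((AᵀA)^{n+1})` over configurations**:
`tr((AᵀA)^{n+1}) = ∑_Q ∑_P ∑_ℓ ∑_{lab} ∑_{lab'} [Valid P Q ℓ lab lab'] ∏_σ g(lab σ) g(lab' σ)`.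
[Allen–O'Donnell–Witmer 2015, App. A.4 (`tr((AAᵀ)^r) = ∑_{J,L} P_{J,L}`)] [cite: arXiv150504383, App. A] -/
theorem trace_pow_oddMatrixOf_tensorOf (b₁ b₂ : Λ → I) (lst : Λ → K) (g : Λ → R) (n : ℕ) :
    (((oddMatrixOf (tensorOf b₁ b₂ lst g))ᵀ * oddMatrixOf (tensorOf b₁ b₂ lst g)) ^ (n + 1)).trace =
      ∑ Q : Fin (n + 1) → I × I, ∑ P : Fin (n + 1) → I × I, ∑ ℓ : Fin (n + 1) × Fin 2 → K,
        ∑ lab : Fin (n + 1) × Fin 2 → Λ, ∑ lab' : Fin (n + 1) × Fin 2 → Λ,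
          if Valid b₁ b₂ lst P Q ℓ lab lab' then ∏ σ, g (lab σ) * g (lab' σ) else 0 := by
  rw [trace_pow_transpose_mul_self]
  refine Finset.sum_congr rfl fun Q _ => Finset.sum_congr rfl fun P _ => ?_
  rw [prod_walk_eq_prod_slots]
  simp only [oddMatrixOf_tensorOf_apply]
  -- distribute the product over the three sums, one at a time
  rw [Fintype.prod_sum]
  refine Finset.sum_congr rfl fun ℓ _ => ?_
  rw [Fintype.prod_sum]
  refine Finset.sum_congr rfl fun lab _ => ?_
  rw [Fintype.prod_sum]
  refine Finset.sum_congr rfl fun lab' _ => ?_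
  -- a product of guarded factors is the guarded product
  by_cases hv : Valid b₁ b₂ lst P Q ℓ lab lab'
  · rw [if_pos hv]
    exact Finset.prod_congr rfl fun σ _ => if_pos (hv σ)
  · rw [if_neg hv]
    simp only [Valid, not_forall] at hv
    obtain ⟨σ, hσ⟩ := hv
    exact Finset.prod_eq_zero (Finset.mem_univ σ) (if_neg hσ)

end Generic

/-! ### Consequences of validity -/

variable {n : ℕ}

/-- The triple of a label. [folklore] -/
def tripleOfLabel (b₁ b₂ : Λ → I) (lst : Λ → K) (x : Λ) : I × I × K := (b₁ x, b₂ x, lst x)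

omit [Fintype I] [Fintype K] [Fintype Λ] [DecidableEq I] [DecidableEq K] [DecidableEq Λ] in
/-- On a valid configuration the labels lie over the configuration's triples.
[Allen–O'Donnell–Witmer 2015, App. A.4] [folklore] -/
theorem Valid.tripleOfLabel_eq {b₁ b₂ : Λ → I} {lst : Λ → K} {P Q : Fin (n + 1) → I × I}
    {ℓ : Fin (n + 1) × Fin 2 → K} {lab lab' : Fin (n + 1) × Fin 2 → Λ}
    (hv : Valid b₁ b₂ lst P Q ℓ lab lab') (σ : Fin (n + 1) × Fin 2) :
    tripleOfLabel b₁ b₂ lst (lab σ) = tripleAt P Q ℓ σ.1 σ.2 0 ∧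
      tripleOfLabel b₁ b₂ lst (lab' σ) = tripleAt P Q ℓ σ.1 σ.2 1 := by
  obtain ⟨-, h0, h1⟩ := hv σ
  rw [overTriple_iff] at h0 h1
  exact ⟨by simpa [tripleOfLabel, tripleAt, blockOf] using h0,
    by simpa [tripleOfLabel, tripleAt, blockOf] using h1⟩

omit [Fintype I] [Fintype K] [Fintype Λ] [DecidableEq I] [DecidableEq K] [DecidableEq Λ] in
/-- On a valid configuration the two triples of a slot differ (off-diagonal entries).
[Allen–O'Donnell–Witmer 2015, App. A.4, Claim 6] [folklore] -/
theorem Valid.tripleAt_ne {b₁ b₂ : Λ → I} {lst : Λ → K} {P Q : Fin (n + 1) → I × I}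
    {ℓ : Fin (n + 1) × Fin 2 → K} {lab lab' : Fin (n + 1) × Fin 2 → Λ}
    (hv : Valid b₁ b₂ lst P Q ℓ lab lab') (t : Fin (n + 1)) (s : Fin 2) :
    tripleAt P Q ℓ t s 0 ≠ tripleAt P Q ℓ t s 1 := by
  intro h
  obtain ⟨hoff, -, -⟩ := hv (t, s)
  simp only [tripleAt, blockOf, Fin.isValue, if_true, one_ne_zero, if_false, Prod.mk.injEq] at h
  exact hoff ⟨h.1, h.2.1⟩

/-- The triples of all labels of a configuration, as a function on `slots ⊕ slots`. [folklore] -/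
def labelTriples (b₁ b₂ : Λ → I) (lst : Λ → K) (lab lab' : Fin (n + 1) × Fin 2 → Λ) :
    (Fin (n + 1) × Fin 2) ⊕ (Fin (n + 1) × Fin 2) → I × I × K :=
  fun x => tripleOfLabel b₁ b₂ lst (Sum.elim lab lab' x)

omit [Fintype Λ] [DecidableEq Λ] in
/-- On a valid configuration the set of triples of the labels is the configuration's `tripleSet`.
[Allen–O'Donnell–Witmer 2015, App. A.4] [folklore] -/
theorem Valid.image_labelTriples_eq {b₁ b₂ : Λ → I} {lst : Λ → K} {P Q : Fin (n + 1) → I × I}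
    {ℓ : Fin (n + 1) × Fin 2 → K} {lab lab' : Fin (n + 1) × Fin 2 → Λ}
    (hv : Valid b₁ b₂ lst P Q ℓ lab lab') :
    univ.image (labelTriples b₁ b₂ lst lab lab') = tripleSet P Q ℓ := by
  ext τ
  simp only [Finset.mem_image, Finset.mem_univ, true_and, tripleSet, labelTriples]
  constructor
  · rintro ⟨x, rfl⟩
    rcases x with σ | σ
    · exact ⟨(σ.1, σ.2, 0), by rw [Sum.elim_inl, (hv.tripleOfLabel_eq σ).1]⟩
    · exact ⟨(σ.1, σ.2, 1), by rw [Sum.elim_inr, (hv.tripleOfLabel_eq σ).2]⟩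
  · rintro ⟨⟨t, s, h⟩, rfl⟩
    have hh : h = 0 ∨ h = 1 := by
      match h with
      | 0 => exact Or.inl rfl
      | 1 => exact Or.inr rfl
    rcases hh with rfl | rfl
    · exact ⟨Sum.inl (t, s), (hv.tripleOfLabel_eq (t, s)).1⟩
    · exact ⟨Sum.inr (t, s), (hv.tripleOfLabel_eq (t, s)).2⟩

/-! ### Counting configurations -/

/-- Transport of the "no singleton ⟹ few distinct values" bound to any finite index type.
[Allen–O'Donnell–Witmer 2015, App. A.4, Claims 8–9] [folklore] -/
theorem two_mul_card_image_le_card {S X : Type} [Fintype S] [DecidableEq X] (f : S → X)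
    (h : ∀ s, ∃ s', s' ≠ s ∧ f s' = f s) : 2 * (univ.image f).card ≤ Fintype.card S := by
  classical
  set e := Fintype.equivFin S
  have himg : univ.image f = univ.image (f ∘ e.symm) := by
    ext x
    simp only [Finset.mem_image, Finset.mem_univ, true_and, Function.comp_apply]
    exact ⟨fun ⟨s, hs⟩ => ⟨e s, by simpa using hs⟩, fun ⟨t, ht⟩ => ⟨e.symm t, ht⟩⟩
  have hns : ∀ t, ∃ t', t' ≠ t ∧ (f ∘ e.symm) t' = (f ∘ e.symm) t := by
    intro t
    obtain ⟨s', hs', hfs⟩ := h (e.symm t)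
    refine ⟨e s', fun ht => hs' ?_, by simpa using hfs⟩
    rw [← ht, Equiv.symm_apply_apply]
  have := two_mul_numLabels_le (f ∘ e.symm) hns
  rw [numLabels, ← himg] at this
  exact this

/-- The block sequence of `(P, Q)`: the `4(n+1)` blocks `P_t.1, P_t.2, Q_t.1, Q_t.2`. [folklore] -/
def blockSeq (PQ : (Fin (n + 1) → I × I) × (Fin (n + 1) → I × I)) : Fin ((n + 1) * 4) → I :=
  fun x =>
    let t := (finProdFinEquiv.symm x).1
    let c := (finProdFinEquiv.symm x).2
    if c = 0 then (PQ.1 t).1 else if c = 1 then (PQ.1 t).2 else if c = 2 then (PQ.2 t).1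
      else (PQ.2 t).2

omit [Fintype I] [Fintype K] [Fintype Λ] [DecidableEq K] [DecidableEq Λ] [DecidableEq I] in
/-- Values of the block sequence. [folklore] -/
theorem blockSeq_apply (PQ : (Fin (n + 1) → I × I) × (Fin (n + 1) → I × I)) (t : Fin (n + 1))
    (c : Fin 4) :
    blockSeq PQ (finProdFinEquiv (t, c)) =
      if c = 0 then (PQ.1 t).1 else if c = 1 then (PQ.1 t).2 else if c = 2 then (PQ.2 t).1
        else (PQ.2 t).2 := by
  simp [blockSeq]

omit [Fintype K] [Fintype Λ] [DecidableEq K] [DecidableEq Λ] in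
/-- The blocks are the values of the block sequence. [folklore] -/
theorem image_blockSeq (PQ : (Fin (n + 1) → I × I) × (Fin (n + 1) → I × I)) :
    univ.image (blockSeq PQ) = blockSet PQ.1 PQ.2 := by
  ext z
  simp only [Finset.mem_image, Finset.mem_univ, true_and, blockSet, Finset.mem_union]
  constructor
  · rintro ⟨x, rfl⟩
    obtain ⟨⟨t, c⟩, rfl⟩ := finProdFinEquiv.surjective x
    rw [blockSeq_apply]
    have hc : c = 0 ∨ c = 1 ∨ c = 2 ∨ c = 3 := by
      match c with
      | 0 => simp
      | 1 => simp
      | 2 => simp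
      | 3 => simp
    rcases hc with rfl | rfl | rfl | rfl
    · exact Or.inl ⟨(t, 0), by simp [blockOf]⟩
    · exact Or.inl ⟨(t, 1), by simp [blockOf]⟩
    · exact Or.inr ⟨(t, 0), by simp [blockOf]⟩
    · exact Or.inr ⟨(t, 1), by simp [blockOf]⟩
  · rintro (⟨⟨t, h⟩, rfl⟩ | ⟨⟨t, h⟩, rfl⟩)
    · have hh : h = 0 ∨ h = 1 := by
        match h with
        | 0 => exact Or.inl rfl
        | 1 => exact Or.inr rfl
      rcases hh with rfl | rfl
      · exact ⟨finProdFinEquiv (t, 0), by rw [blockSeq_apply]; simp [blockOf]⟩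
      · exact ⟨finProdFinEquiv (t, 1), by rw [blockSeq_apply]; simp [blockOf]⟩
    · have hh : h = 0 ∨ h = 1 := by
        match h with
        | 0 => exact Or.inl rfl
        | 1 => exact Or.inr rfl
      rcases hh with rfl | rfl
      · exact ⟨finProdFinEquiv (t, 2), by rw [blockSeq_apply]; simp [blockOf]⟩
      · exact ⟨finProdFinEquiv (t, 3), by rw [blockSeq_apply]; simp [blockOf]⟩

omit [Fintype I] [Fintype K] [Fintype Λ] [DecidableEq K] [DecidableEq Λ] [DecidableEq I] in
/-- The block sequence determines `(P, Q)`. [folklore] -/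
theorem blockSeq_injective :
    Function.Injective (blockSeq (I := I) (n := n)) := by
  rintro ⟨P, Q⟩ ⟨P', Q'⟩ h
  have hv : ∀ t c, blockSeq (P, Q) (finProdFinEquiv (t, c)) = blockSeq (P', Q') (finProdFinEquiv (t, c)) :=
    fun t c => congr_fun h _
  refine Prod.ext (funext fun t => Prod.ext ?_ ?_) (funext fun t => Prod.ext ?_ ?_)
  · have h0 := hv t 0
    rw [blockSeq_apply, blockSeq_apply] at h0
    simpa using h0
  · have h0 := hv t 1
    rw [blockSeq_apply, blockSeq_apply] at h0
    simpa using h0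
  · have h0 := hv t 2
    rw [blockSeq_apply, blockSeq_apply] at h0
    simpa using h0
  · have h0 := hv t 3
    rw [blockSeq_apply, blockSeq_apply] at h0
    simpa using h0

/-- The trivial adjacency (every label adjacent to every label). [folklore] -/
def trivAdj (X : Type) : ℕ → X → X → Prop := fun _ _ _ => True

/-- `trivAdj` is decidable. [folklore] -/
instance instDecidableTrivAdj (X : Type) (t : ℕ) (a b : X) : Decidable (trivAdj X t a b) :=
  isTrue trivial

/-- **Counting row/column pair sequences by their number of blocks** (AOW: "the number of choices
of `J` with `|J| = a` is at most `n^{a(k-1)/2} a^{4r}`"):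
`#{(P,Q) : a blocks} ≤ |I| · (4(n+1))^{4(n+1)-1} · |I|^{a-1}`.
[Allen–O'Donnell–Witmer 2015, App. A.4] [cite: arXiv150504383, App. A] -/
theorem card_filter_blockSet_le {a : ℕ} (ha : 1 ≤ a) :
    ((univ : Finset ((Fin (n + 1) → I × I) × (Fin (n + 1) → I × I))).filter
        fun PQ => (blockSet PQ.1 PQ.2).card = a).card ≤
      Fintype.card I * ((n + 1) * 4) ^ ((n + 1) * 4 - 1) * Fintype.card I ^ (a - 1) := by
  have hD : ∀ (t : ℕ) (x : I), (univ.filter (trivAdj I t x)).card ≤ Fintype.card I :=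
    fun t x => Finset.card_filter_le _ _ |>.trans (by simp)
  refine le_trans ?_ (card_adjSeqs_le' (trivAdj I) hD (N := (n + 1) * 4) (by positivity) ha)
  refine Finset.card_le_card_of_injOn blockSeq (fun PQ hPQ => ?_) fun _ _ _ _ h => blockSeq_injective h
  rw [Finset.coe_filter, Set.mem_setOf_eq] at hPQ
  rw [Finset.mem_coe, mem_adjSeqs]
  exact ⟨fun _ _ _ => trivial, by rw [numLabels, image_blockSeq]; exact hPQ.2⟩

/-- **Counting last-coordinate assignments by their number of values**:
`#{ℓ : b values} ≤ |K| · (2(n+1))^{2(n+1)-1} · |K|^{b-1}`.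
[Allen–O'Donnell–Witmer 2015, App. A.4 ("the number of choices of `L` with `|L| = b` is at most
`n^b b^{2r}`")] [cite: arXiv150504383, App. A] -/
theorem card_filter_image_lst_le {b : ℕ} (hb : 1 ≤ b) :
    ((univ : Finset (Fin (n + 1) × Fin 2 → K)).filter fun ℓ => (univ.image ℓ).card = b).card ≤
      Fintype.card K * ((n + 1) * 2) ^ ((n + 1) * 2 - 1) * Fintype.card K ^ (b - 1) := by
  have hD : ∀ (t : ℕ) (x : K), (univ.filter (trivAdj K t x)).card ≤ Fintype.card K :=
    fun t x => Finset.card_filter_le _ _ |>.trans (by simp)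
  refine le_trans ?_ (card_adjSeqs_le' (trivAdj K) hD (N := (n + 1) * 2) (by positivity) hb)
  refine Finset.card_le_card_of_injOn (fun ℓ => ℓ ∘ finProdFinEquiv.symm) (fun ℓ hℓ => ?_)
    fun ℓ _ ℓ' _ h => ?_
  · rw [Finset.coe_filter, Set.mem_setOf_eq] at hℓ
    rw [Finset.mem_coe, mem_adjSeqs]
    refine ⟨fun _ _ _ => trivial, ?_⟩
    rw [numLabels, ← hℓ.2]
    congr 1
    ext v
    simp only [Finset.mem_image, Finset.mem_univ, true_and, Function.comp_apply]
    exact ⟨fun ⟨x, hx⟩ => ⟨_, hx⟩, fun ⟨σ, hσ⟩ => ⟨finProdFinEquiv σ, by simpa using hσ⟩⟩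
  · funext σ
    have := congr_fun h (finProdFinEquiv σ)
    simpa using this

omit [Fintype I] [Fintype K] [DecidableEq Λ] in
/-- **Counting the valid label assignments of a configuration**: if every triple carries at most
`λ₀` labels then `∑_{lab, lab'} [Valid] ≤ λ₀^{2(n+1)} · λ₀^{2(n+1)}` (as reals).
[Allen–O'Donnell–Witmer 2015, Cor. 4.2 (`2^k` sign patterns per scope)] [folklore] -/
theorem sum_valid_labels_le (b₁ b₂ : Λ → I) (lst : Λ → K) {lam0 : ℕ}
    (hfib : ∀ τ : I × I × K, (univ.filter fun x => OverTriple b₁ b₂ lst x τ).card ≤ lam0)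
    (P Q : Fin (n + 1) → I × I) (ℓ : Fin (n + 1) × Fin 2 → K) :
    (∑ lab : Fin (n + 1) × Fin 2 → Λ, ∑ lab' : Fin (n + 1) × Fin 2 → Λ,
        (if Valid b₁ b₂ lst P Q ℓ lab lab' then (1 : ℝ) else 0)) ≤
      (lam0 : ℝ) ^ ((n + 1) * 2) * (lam0 : ℝ) ^ ((n + 1) * 2) := by
  -- drop the off-diagonal condition and split the two label families
  have hle : ∀ lab lab' : Fin (n + 1) × Fin 2 → Λ,
      (if Valid b₁ b₂ lst P Q ℓ lab lab' then (1 : ℝ) else 0) ≤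
        (∏ σ, if OverTriple b₁ b₂ lst (lab σ) ((P σ.1).1, (colPair Q σ.1 σ.2).1, ℓ σ) then (1 : ℝ) else 0) *
          ∏ σ, if OverTriple b₁ b₂ lst (lab' σ) ((P σ.1).2, (colPair Q σ.1 σ.2).2, ℓ σ) then (1 : ℝ) else 0 := by
    intro lab lab'
    split_ifs with hv
    · rw [Finset.prod_eq_one fun σ _ => if_pos (hv σ).2.1, Finset.prod_eq_one fun σ _ => if_pos (hv σ).2.2,
        mul_one]
    · exact mul_nonneg (Finset.prod_nonneg fun σ _ => by split_ifs <;> norm_num)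
        (Finset.prod_nonneg fun σ _ => by split_ifs <;> norm_num)
  have hcount : ∀ (τ : Fin (n + 1) × Fin 2 → I × I × K),
      ∑ lab : Fin (n + 1) × Fin 2 → Λ, (∏ σ, if OverTriple b₁ b₂ lst (lab σ) (τ σ) then (1 : ℝ) else 0) ≤
        (lam0 : ℝ) ^ ((n + 1) * 2) := by
    intro τ
    rw [← Fintype.prod_sum (fun σ x => if OverTriple b₁ b₂ lst x (τ σ) then (1 : ℝ) else 0)]
    calc ∏ σ, ∑ x, (if OverTriple b₁ b₂ lst x (τ σ) then (1 : ℝ) else 0)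
        ≤ ∏ _σ : Fin (n + 1) × Fin 2, (lam0 : ℝ) := by
          refine Finset.prod_le_prod (fun σ _ => Finset.sum_nonneg fun x _ => by split_ifs <;> norm_num)
            fun σ _ => ?_
          rw [Finset.sum_boole]
          exact_mod_cast hfib (τ σ)
      _ = (lam0 : ℝ) ^ ((n + 1) * 2) := by
          rw [Finset.prod_const, Finset.card_univ, Fintype.card_prod, Fintype.card_fin, Fintype.card_fin]
  calc (∑ lab : Fin (n + 1) × Fin 2 → Λ, ∑ lab' : Fin (n + 1) × Fin 2 → Λ,
        (if Valid b₁ b₂ lst P Q ℓ lab lab' then (1 : ℝ) else 0))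
      ≤ ∑ lab : Fin (n + 1) × Fin 2 → Λ, ∑ lab' : Fin (n + 1) × Fin 2 → Λ,
          (∏ σ, if OverTriple b₁ b₂ lst (lab σ) ((P σ.1).1, (colPair Q σ.1 σ.2).1, ℓ σ) then (1 : ℝ) else 0) *
            ∏ σ, if OverTriple b₁ b₂ lst (lab' σ) ((P σ.1).2, (colPair Q σ.1 σ.2).2, ℓ σ) then (1 : ℝ) else 0 :=
        Finset.sum_le_sum fun lab _ => Finset.sum_le_sum fun lab' _ => hle lab lab'
    _ = (∑ lab : Fin (n + 1) × Fin 2 → Λ,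
          ∏ σ, if OverTriple b₁ b₂ lst (lab σ) ((P σ.1).1, (colPair Q σ.1 σ.2).1, ℓ σ) then (1 : ℝ) else 0) *
        ∑ lab' : Fin (n + 1) × Fin 2 → Λ,
          ∏ σ, if OverTriple b₁ b₂ lst (lab' σ) ((P σ.1).2, (colPair Q σ.1 σ.2).2, ℓ σ) then (1 : ℝ) else 0 := by
        rw [Finset.sum_mul_sum]
    _ ≤ (lam0 : ℝ) ^ ((n + 1) * 2) * (lam0 : ℝ) ^ ((n + 1) * 2) :=
        mul_le_mul (hcount _) (hcount _) (Finset.sum_nonneg fun lab' _ =>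
          Finset.prod_nonneg fun σ _ => by split_ifs <;> norm_num) (by positivity)

/-! ### Claim 10: the arithmetic of the exponents -/

/-- **Claim 10 (AOW)**: for `1 ≤ a ≤ 2m+3`, `b ≤ m`, `N, ν ≥ 1`, `0 ≤ p ≤ 1` and `N² ν p² ≥ 1`,
`N^a ν^b p^{max(2b, a-3)} ≤ N^4 (N² ν p²)^m`. [Allen–O'Donnell–Witmer 2015, App. A.4, Claim 10
(with `a - 2`; the shift by one is immaterial)] [cite: arXiv150504383, App. A] -/
theorem claim10 {N ν p : ℝ} (hN : 1 ≤ N) (hν : 1 ≤ ν) (hp0 : 0 ≤ p) (hp1 : p ≤ 1)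
    (hreg : 1 ≤ N ^ 2 * ν * p ^ 2) {m a b : ℕ} (ha : a ≤ 2 * m + 3) (hb : b ≤ m) :
    N ^ a * ν ^ b * p ^ max (2 * b) (a - 3) ≤ N ^ 4 * (N ^ 2 * ν * p ^ 2) ^ m := by
  have hN0 : 0 ≤ N := by linarith
  have hν0 : 0 ≤ ν := by linarith
  have hX : ∀ {c : ℕ}, c ≤ m → (N ^ 2 * ν * p ^ 2) ^ c ≤ (N ^ 2 * ν * p ^ 2) ^ m :=
    fun hc => pow_le_pow_right₀ hreg hc
  rcases le_or_gt (a - 3) (2 * b) with hcase | hcase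
  · -- `max = 2b`, `a ≤ 2b + 3`
    rw [max_eq_left hcase]
    have ha' : a ≤ 2 * b + 3 := by omega
    calc N ^ a * ν ^ b * p ^ (2 * b) ≤ N ^ (2 * b + 3) * ν ^ b * p ^ (2 * b) :=
          mul_le_mul_of_nonneg_right (mul_le_mul_of_nonneg_right (pow_le_pow_right₀ hN ha')
            (by positivity)) (by positivity)
      _ = N ^ 3 * (N ^ 2 * ν * p ^ 2) ^ b := by ring
      _ ≤ N ^ 4 * (N ^ 2 * ν * p ^ 2) ^ m := by
          apply mul_le_mul (pow_le_pow_right₀ hN (by norm_num)) (hX hb) (by positivity) (by positivity)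
  · -- `max = a - 3 = 2c + e`, `b ≤ c ≤ m`
    rw [max_eq_right hcase.le]
    obtain ⟨c, e, he, hce⟩ : ∃ c e : ℕ, e ≤ 1 ∧ a - 3 = 2 * c + e :=
      ⟨(a - 3) / 2, (a - 3) % 2, by omega, by omega⟩
    have hbc : b ≤ c := by omega
    have hcm : c ≤ m := by omega
    have ha3 : a = 3 + (2 * c + e) := by omega
    rw [hce, ha3]
    calc N ^ (3 + (2 * c + e)) * ν ^ b * p ^ (2 * c + e)
        ≤ N ^ (3 + (2 * c + e)) * ν ^ c * p ^ (2 * c) :=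
          mul_le_mul (mul_le_mul_of_nonneg_left (pow_le_pow_right₀ hν hbc) (by positivity))
            (pow_le_pow_of_le_one hp0 hp1 (by omega)) (by positivity) (by positivity)
      _ = N ^ (3 + e) * (N ^ 2 * ν * p ^ 2) ^ c := by ring
      _ ≤ N ^ 4 * (N ^ 2 * ν * p ^ 2) ^ m := by
          apply mul_le_mul (pow_le_pow_right₀ hN (by omega)) (hX hcm) (by positivity) (by positivity)

end Literature.Computability.Complexity
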